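import Mathlib
import HarnessLib
import Literature.Computability.AlgebraicComplexity.LaserComponentTools
import Summits.MatrixMultiplication.MatrixMultiplication.Theorems.OutsiderSandwichTightSubrank
import Summits.MatrixMultiplication.MatrixMultiplication.Theorems.OutsiderSandwichCouplingDiagonal
import Summits.MatrixMultiplication.MatrixMultiplication.Theorems.OutsiderSandwichCouplingBenchmark
import Summits.MatrixMultiplication.MatrixMultiplication.Theorems.OutsiderSandwichBlockItems

/-!
# OutsiderSandwich — `Q̃(C₁) ≥ 4`: `BlockDiagonal` and `BlockSubrankFull` hold, the block layer is unconditional (decomp-mm lens-4, g17)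

Closes items 28537 `BlockDiagonal` and 28536 `BlockSubrankFull` of `Theses/OutsiderSandwich.lean`
and makes the g17 block layer unconditional:

1. `four_le_asymptoticSubrank_coupling₁ : 4 ≤ Q̃(C₁)` — Strassen's bound for tight supports
   (`OutsiderSandwichTightSubrank.le_asymptoticSubrank_of_tight`) on the support of the coupled CW
   block `C₁` in its normal form (`OutsiderSandwichBlockNormalForm.coupling₁_apply`): the 8-point
   support `suppC₁` is tight for the integer labels `α(x) = (−10,−11,−30,−31)`,
   `β(y) = γ(z) = (0,1,10,30)` (`tight_tables`), and the uniform distribution on it has all three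
   marginals uniform on `Fin 4` (entropy `2`) and is a product on the support (penalty `0`).
2. `blockDiagonal_holds : BlockDiagonal` — one common diagonal `⟨r⟩ ≤ C_k^{⊠N}`, `4^N ≤ r 2^{εN}`,
   cofinally in `N`, for `k = 1,2,3` (`exists_diagonal_of_le_asymptoticSubrank` for `C₁`, transported
   to `C₃ = (C₁)_C`, `C₂ = (C₁)_{C²}` by rotation invariance of diagonals).
3. `blockSubrankFull_holds : BlockSubrankFull` (`4 ≤ F(C_k)` at every universal spectral point,
   tree `blockSubrankFull_of_diagonal`), hence the UNCONDITIONAL refined block cut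
   `summit_iff_blockIsMM : ω = 2 ⟺ BlockIsMM ∧ CouplingMergeOptimal` and
   `blockIsMM_of_summit : ω = 2 ⟹ BlockIsMM` (the ω-free leaf `⟨2,2,2⟩ ≲ C_k` is NECESSARY).
4. The items by name: `blockDiagonal_item` (28537), `blockSubrankFull_item` (28536),
   `summit_iff_blockIsMM_items`.
-/

noncomputable section

namespace Summit.MatrixMultiplication.MatrixMultiplication.Theorems.OutsiderSandwichBlockSubrank

open Literature.Computability.AlgebraicComplexity
open Summit.MatrixMultiplication.MatrixMultiplication.Theorems.OutsiderSandwichCoupling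
open Summit.MatrixMultiplication.MatrixMultiplication.Theorems.OutsiderSandwichBlockNormalForm
open Summit.MatrixMultiplication.MatrixMultiplication.Theorems.OutsiderSandwichTightSubrank

/-! ## 1. The support of `C₁` and its tight labelling -/

/-- The support of `C₁` (8 points), read off the normal form. -/
def suppC₁ : Finset (Fin 4 × Fin 4 × Fin 4) :=
  Finset.univ.filter fun s => blockOneSupp s.1 s.2.1 s.2.2

/-- Membership in `suppC₁`. -/
theorem mem_suppC₁ {s : Fin 4 × Fin 4 × Fin 4} : s ∈ suppC₁ ↔ blockOneSupp s.1 s.2.1 s.2.2 := by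
  simp [suppC₁]

/-- `C₁(a,b,c) ≠ 0 ⟺ (a,b,c)` is a support point. -/
theorem coupling₁_ne_zero_iff (a b c : Fin 4) : coupling₁ a b c ≠ 0 ↔ blockOneSupp a b c := by
  rw [coupling₁_apply]
  split_ifs with h <;> simp [h]

/-- `supp C₁ ⊆ suppC₁`. -/
theorem mem_suppC₁_of_ne_zero (a b c : Fin 4) (h : coupling₁ a b c ≠ 0) : (a, b, c) ∈ suppC₁ :=
  mem_suppC₁.2 ((coupling₁_ne_zero_iff a b c).1 h)

/-- `suppC₁ ⊆ supp C₁`. -/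
theorem ne_zero_of_mem_suppC₁ (s : Fin 4 × Fin 4 × Fin 4) (hs : s ∈ suppC₁) :
    coupling₁ s.1 s.2.1 s.2.2 ≠ 0 :=
  (coupling₁_ne_zero_iff _ _ _).2 (mem_suppC₁.1 hs)

/-- `|suppC₁| = 8`. -/
theorem card_suppC₁ : suppC₁.card = 8 := by
  decide

/-- The `x`-labels `α(x_a) = (−10, −11, −30, −31)` (`a ≅ (row, col)`, `α = −B₀(col) − B₁(row)` with
`B₀ = (0,1)`, `B₁ = (10,30)`). -/
def labX : Fin 4 → ℤ := ![-10, -11, -30, -31]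

/-- The `y`- and `z`-labels `(0, 1, 10, 30)` (`b ≅ (half, pos)`, `B_half(pos)`). -/
def labYZ : Fin 4 → ℤ := ![0, 1, 10, 30]

/-- **Tightness**: `α + β + γ = 0` on the support of `C₁`. -/
theorem tight_tables : ∀ a b c : Fin 4, blockOneSupp a b c → labX a + labYZ b + labYZ c = 0 := by
  decide

/-- `labX` is injective. -/
theorem labX_injective : Function.Injective labX := by
  decide

/-- `labYZ` is injective. -/
theorem labYZ_injective : Function.Injective labYZ := by
  decide

/-- `|labX| ≤ 31`. -/
theorem abs_labX_le : ∀ a : Fin 4, |labX a| ≤ 31 := by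
  decide

/-- `|labYZ| ≤ 31`. -/
theorem abs_labYZ_le : ∀ b : Fin 4, |labYZ b| ≤ 31 := by
  decide

/-! ## 2. The uniform distribution on the support: marginals and penalty -/

/-- The count vector: indicator of `suppC₁`. -/
def cnt : Fin 4 × Fin 4 × Fin 4 → ℕ := fun s => if s ∈ suppC₁ then 1 else 0

/-- `cnt` vanishes off the support. -/
theorem cnt_eq_zero (s : Fin 4 × Fin 4 × Fin 4) (hs : s ∉ suppC₁) : cnt s = 0 := by
  simp [cnt, hs]

/-- `∑ cnt = 8`. -/
theorem sum_cnt : ∑ s, cnt s = 8 := by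
  simp only [cnt, Finset.sum_boole, Nat.cast_id, Finset.filter_mem_eq_inter, Finset.univ_inter,
    card_suppC₁]

/-- The uniform probability distribution `P = cnt / 8` on `suppC₁`. -/
def unifP : Fin 4 × Fin 4 × Fin 4 → ℝ := fun s => (cnt s : ℝ) / 8

/-- `P = cnt / 8` in the form the counting theorem wants. -/
theorem unifP_eq (s : Fin 4 × Fin 4 × Fin 4) : unifP s = (cnt s : ℝ) / ((8 : ℕ) : ℝ) := by
  simp [unifP]

/-- `P = 1/8` on the support. -/
theorem unifP_of_mem {s : Fin 4 × Fin 4 × Fin 4} (hs : s ∈ suppC₁) : unifP s = 1 / 8 := by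
  simp [unifP, cnt, hs]

/-- `P = 0` off the support. -/
theorem unifP_of_not_mem (s : Fin 4 × Fin 4 × Fin 4) (hs : s ∉ suppC₁) : unifP s = 0 := by
  simp [unifP, cnt, hs]

/-- `P` as an indicator of `blockOneSupp`. -/
theorem unifP_apply (a b c : Fin 4) : unifP (a, b, c) = if blockOneSupp a b c then 1 / 8 else 0 := by
  by_cases h : blockOneSupp a b c
  · rw [if_pos h, unifP_of_mem (mem_suppC₁.2 h)]
  · rw [if_neg h, unifP_of_not_mem _ (fun hs => h (mem_suppC₁.1 hs))]

/-- `0 ≤ P`. -/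
theorem unifP_nonneg (s : Fin 4 × Fin 4 × Fin 4) : 0 ≤ unifP s := by
  unfold unifP; positivity

/-- `∑ P = 1`. -/
theorem sum_unifP : ∑ s, unifP s = 1 := by
  simp only [unifP]
  rw [← Finset.sum_div, ← Nat.cast_sum, sum_cnt]
  norm_num

/-- A sum of a constant over a decidable predicate. -/
theorem sum_ite_const {α : Type} [Fintype α] (p : α → Prop) [DecidablePred p] (x : ℝ) :
    ∑ a, (if p a then x else 0) = ((Finset.univ.filter p).card : ℝ) * x := by
  rw [← Finset.sum_filter, Finset.sum_const, nsmul_eq_mul]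

/-- Every `x`-row of the support has 2 points. -/
theorem rowCount₁ : ∀ a : Fin 4,
    (Finset.univ.filter fun bc : Fin 4 × Fin 4 => blockOneSupp a bc.1 bc.2).card = 2 := by
  decide

/-- Every `y`-row of the support has 2 points. -/
theorem rowCount₂ : ∀ b : Fin 4,
    (Finset.univ.filter fun ac : Fin 4 × Fin 4 => blockOneSupp ac.1 b ac.2).card = 2 := by
  decide

/-- Every `z`-row of the support has 2 points. -/
theorem rowCount₃ : ∀ c : Fin 4,
    (Finset.univ.filter fun ab : Fin 4 × Fin 4 => blockOneSupp ab.1 ab.2 c).card = 2 := by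
  decide

/-- The `x`-marginal of `P` is uniform on `Fin 4`. -/
theorem marginalDist₁_unifP : marginalDist₁ unifP = fun _ => 1 / 4 := by
  funext a
  simp only [marginalDist₁]
  rw [(Fintype.sum_prod_type' fun b c => unifP (a, b, c)).symm]
  simp only [unifP_apply]
  rw [sum_ite_const, rowCount₁ a]
  norm_num

/-- The `y`-marginal of `P` is uniform on `Fin 4`. -/
theorem marginalDist₂_unifP : marginalDist₂ unifP = fun _ => 1 / 4 := by
  funext b
  simp only [marginalDist₂]
  rw [(Fintype.sum_prod_type' fun a c => unifP (a, b, c)).symm]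
  simp only [unifP_apply]
  rw [sum_ite_const, rowCount₂ b]
  norm_num

/-- The `z`-marginal of `P` is uniform on `Fin 4`. -/
theorem marginalDist₃_unifP : marginalDist₃ unifP = fun _ => 1 / 4 := by
  funext c
  simp only [marginalDist₃]
  rw [(Fintype.sum_prod_type' fun a b => unifP (a, b, c)).symm]
  simp only [unifP_apply]
  rw [sum_ite_const, rowCount₃ c]
  norm_num

/-- `H(uniform on Fin 4) = 2`. -/
theorem shannonEntropy_quarter : shannonEntropy (fun _ : Fin 4 => (1 / 4 : ℝ)) = 2 := by
  rw [shannonEntropy_def, Finset.sum_const, Finset.card_univ, Fintype.card_fin, nsmul_eq_mul]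
  have hl : Real.log 2 ≠ 0 := (Real.log_pos one_lt_two).ne'
  have h : Real.negMulLog (1 / 4 : ℝ) = Real.log 2 / 2 := by
    rw [Real.negMulLog, one_div, Real.log_inv, show (4 : ℝ) = 2 ^ 2 by norm_num, Real.log_pow]
    push_cast
    ring
  rw [h]
  field_simp
  push_cast
  ring

/-- No penalty: `P` is a product of one-variable functions on its support. -/
theorem maxEntropyPenalty_unifP : maxEntropyPenalty suppC₁ unifP = 0 :=
  maxEntropyPenalty_eq_zero_of_mul suppC₁ ⟨unifP_nonneg, sum_unifP⟩ unifP_of_not_mem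
    (fun _ => 1 / 8) (fun _ => 1) (fun _ => 1) (fun _ _ => by norm_num) (fun _ _ => one_pos)
    (fun _ _ => one_pos) (fun s hs => by rw [unifP_of_mem hs]; ring)

/-! ## 3. `Q̃(C₁) ≥ 4` -/

/-- **`4 ≤ Q̃(C₁)`** — Strassen's bound `2^{min_m H(P_m) − Γ}` with `H = (2,2,2)`, `Γ = 0`. -/
theorem four_le_asymptoticSubrank_coupling₁ : (4 : ℝ) ≤ asymptoticSubrank ℂ coupling₁ := by
  have h := le_asymptoticSubrank_of_tight coupling₁ suppC₁ mem_suppC₁_of_ne_zero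
    ne_zero_of_mem_suppC₁ (fun a (_ : Fin 1) => labX a) (fun b (_ : Fin 1) => labYZ b)
    (fun c (_ : Fin 1) => labYZ c) (fun _ _ h => labX_injective (congrFun h 0))
    (fun _ _ h => labYZ_injective (congrFun h 0)) (fun _ _ h => labYZ_injective (congrFun h 0))
    (fun a _ => abs_labX_le a) (fun b _ => abs_labYZ_le b)
    (fun s hs _ => tight_tables _ _ _ (mem_suppC₁.1 hs)) cnt cnt_eq_zero (d := 8) (by norm_num)
    sum_cnt unifP unifP_eq
  rw [marginalDist₁_unifP, marginalDist₂_unifP, marginalDist₃_unifP, shannonEntropy_quarter,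
    maxEntropyPenalty_unifP, min_self, min_self, sub_zero, Real.rpow_two] at h
  norm_num at h
  exact h

/-! ## 4. `BlockDiagonal` and `BlockSubrankFull` hold -/

/-- **`BlockDiagonal` holds** (item 28537): one common diagonal for the three blocks, cofinally. -/
theorem blockDiagonal_holds : OutsiderSandwichBlock.BlockDiagonal := by
  intro ε hε N₀
  obtain ⟨N, hN, r, hr, hb⟩ :=
    OutsiderSandwichCouplingDiagonal.exists_diagonal_of_le_asymptoticSubrank coupling₁
      (by norm_num) four_le_asymptoticSubrank_coupling₁ hε N₀
  refine ⟨N, hN, r, ⟨hr, ?_, ?_⟩, hb⟩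
  · rw [OutsiderSandwichCouplingBenchmark.coupling₂_eq_rotate_rotate]
    exact restrictsTo_unitTensor_kroneckerPow_rotate _
      (restrictsTo_unitTensor_kroneckerPow_rotate _ hr)
  · rw [OutsiderSandwichCouplingBenchmark.coupling₃_eq_rotate]
    exact restrictsTo_unitTensor_kroneckerPow_rotate _ hr

/-- **`BlockSubrankFull` holds** (item 28536): `4 ≤ F(C_k)` at every universal spectral point. -/
theorem blockSubrankFull_holds : OutsiderSandwichBlock.BlockSubrankFull :=
  OutsiderSandwichBlock.blockSubrankFull_of_diagonal blockDiagonal_holds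

/-- `4 ≤ Q̃(C_k)` for all three blocks. -/
theorem four_le_asymptoticSubrank_couplings :
    (4 : ℝ) ≤ asymptoticSubrank ℂ coupling₁ ∧ (4 : ℝ) ≤ asymptoticSubrank ℂ coupling₂ ∧
      (4 : ℝ) ≤ asymptoticSubrank ℂ coupling₃ := by
  refine ⟨four_le_asymptoticSubrank_coupling₁, ?_, ?_⟩
  · obtain ⟨F, hF, hFt⟩ := (strassen_duality_asymptoticSubrank_holds ℂ coupling₂).2
    rw [← hFt]; exact (blockSubrankFull_holds F hF).2.1
  · obtain ⟨F, hF, hFt⟩ := (strassen_duality_asymptoticSubrank_holds ℂ coupling₃).2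
    rw [← hFt]; exact (blockSubrankFull_holds F hF).2.2

/-! ## 5. The unconditional block layer -/

/-- **`ω = 2 ⟺ BlockIsMM ∧ CouplingMergeOptimal`**, unconditionally. -/
theorem summit_iff_blockIsMM :
    _root_.MatrixMultiplication ↔ OutsiderSandwichBlock.BlockIsMM ∧ CouplingMergeOptimal :=
  OutsiderSandwichBlock.summit_iff_blockIsMM blockSubrankFull_holds

/-- **The leaf is necessary**: `ω = 2 ⟹ ⟨2,2,2⟩ ≲ C_k` for `k = 1,2,3`. -/
theorem blockIsMM_of_summit (hS : _root_.MatrixMultiplication) : OutsiderSandwichBlock.BlockIsMM :=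
  OutsiderSandwichBlock.blockIsMM_of_summit blockSubrankFull_holds hS

/-! ## 6. The items by name -/

/-- Item 28537 `BlockDiagonal`, by name. -/
theorem blockDiagonal_item : Theses.OutsiderSandwich.BlockDiagonal :=
  OutsiderSandwichBlockItems.blockDiagonal_iff.2 blockDiagonal_holds

/-- Item 28536 `BlockSubrankFull`, by name. -/
theorem blockSubrankFull_item : Theses.OutsiderSandwich.BlockSubrankFull :=
  OutsiderSandwichBlockItems.blockSubrankFull_iff.2 blockSubrankFull_holds

/-- `ω = 2 ⟺ BlockIsMM ∧ CouplingMergeOptimal` over the route decls, unconditionally. -/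
theorem summit_iff_blockIsMM_items :
    _root_.MatrixMultiplication ↔
      (Theses.OutsiderSandwich.BlockIsMM ∧ Theses.OutsiderSandwich.CouplingMergeOptimal) :=
  OutsiderSandwichBlockItems.summitIffBlockIsMM_holds blockSubrankFull_item

/-- `ω = 2 ⟹ BlockIsMM` over the route decls, unconditionally. -/
theorem blockIsMM_of_summit_items (hS : _root_.MatrixMultiplication) :
    Theses.OutsiderSandwich.BlockIsMM :=
  OutsiderSandwichBlockItems.blockIsMM_of_summit blockSubrankFull_item hS

end Summit.MatrixMultiplication.MatrixMultiplication.Theorems.OutsiderSandwichBlockSubrank
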